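import Literature.Computability.QuantumComplexity.PauliRotationLetterLawExactness
import HarnessLib

/-!
# Two-layer letter laws of Clifford-angle rotations: exact on one wire with no exact layer, never on two or more wires

OBJECT.  Fix `n` wires (`ι`) and TWO finite letter families `A : κA → (ι → Pauli)` (the FIRST layer) and
`B : κB → (ι → Pauli)` (the SECOND layer), repetitions and the identity letter allowed — exactly the letter
families of `PauliRotationLetterLawExactness` (its one-wire inhabitant `nonIdLetters` excludes `I` by choice, its
theorems quantify over every `P : κ → (ι → Pauli)`; `R_I(π/2)` is the trivial rotation).  The two-layer letter law is
the ensemble of Clifford unitaries spelled by the pairs `(a, b) : κA × κB` (`pwordU A B` = `RotationWords.wordU 2`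
of the word `![A a, B b]`), carrying each Pauli label `T` to `pwalk A B (a, b) T = B b ▸ (A a ▸ T)` (`▸` =
`cliffStep` of `WeightTruncationTransientFloor`; `pwalk_apply`).  «Exactly Clifford–Pauli mixing» is the tree's
interface `IsCliffordMixingLayer (pwordU A B) (pwalk A B)` (`PauliMixingWitness`) for the COMPOSED walk: every pair
of non-identity labels is joined by exactly `|κA|·|κB| / (4ⁿ − 1)` pairs.  `PauliRotationLetterLawExactness` settled the
i.i.d. case (ONE family at every position: exact at depth `L + 1` ⟺ exact at depth `1`; never on `n ≥ 2` wires);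
this file treats the first POSITION-DEPENDENT letter laws — two layers with different families — and decides them.

LEVER 1 (the defect criterion; kernel algebra of `PauliRotationLetterLawExactness` BY NAME).  On the `N = 4ⁿ − 1`
non-identity labels each family has a SYMMETRIC one-step kernel `K_P = D_P + (|κ_P|/N)·J` with `D_P J = J D_P = 0`
(`LetterLaw.kernel`, `defect`, `ones`, `kernel_transpose`, `defect_mul_ones`, `ones_mul_defect`).  For TWO families
the cross terms still die, `K_A K_B = D_A D_B + (|κA||κB|/N)·J` (`kernel_mul_kernel`), and the pair count IS the
matrix product (Chapman–Kolmogorov, `lcount2_eq_sum`, `kernel_mul_kernel_apply`).  Hence «the pair is exact» ⟺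
`D_A D_B = 0` (`isCliffordMixingLayer_pair_iff_defect`) while «one layer exact» ⟺ `D = 0`
(`isCliffordMixingLayer_one_iff_defect`); on the diagonal `A = B` this is `D² = 0 ⟺ D = 0`, the depth-two case of
the all-or-nothing law (`isCliffordMixingLayer_pair_self_iff`, via `LetterLaw.kernel_pow_eq_iff` BY NAME).  OFF the
diagonal the symmetric-nilpotent descent is gone: on ONE wire `A = {I, X, Z}`, `B = {I, Y}` have `D_A ≠ 0 ≠ D_B`,
`D_A D_B = 0` — an exactly mixing pair with NO exactly mixing layer (§ 7; the permutations are an exact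
factorisation of `Sym{X, Y, Z}`).
LEVER 2 (the trace obstruction, new here).  A label commuting with both letters is FIXED by the pair step, and by
character orthogonality (`PauliPath.sum_strSign_mul_strSign` BY NAME) at least `4ⁿ/4` labels commute with any two
given strings (`pow_le_four_mul_card_comm`); so `tr(K_A K_B) = Σ_{U ≠ I} lcount2 U U ≥ |κA||κB|·(4ⁿ/4 − 1)`
(`sum_lcount2_self_ge`), whereas exactness forces `tr = N · |κA||κB|/N = |κA||κB|`.  For `n ≥ 2` this is
`3 ≤ 1`: NO two-layer letter law is exactly mixing on two or more wires (`not_isCliffordMixingLayer_pair`).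

RECORDS.
* `kernel_mul_kernel`, `kernel_mul_kernel_eq_iff`, `transpose_kernel_mul_kernel` — `K_A K_B = D_A D_B + (|κA||κB|/N) J`,
  flat ⟺ `D_A D_B = 0`, `(K_A K_B)ᵀ = K_B K_A`;
* `isCliffordMixingLayer_pair_iff` / `_iff_kernel` / `_iff_defect` — THE TWO-LAYER CRITERION;
  `isCliffordMixingLayer_pair_comm` — ORDER SYMMETRY («`A` then `B`» exact ⟺ «`B` then `A`» exact);
* `dvd_of_isCliffordMixingLayer_pair` — INTEGRALITY `(4ⁿ − 1) ∣ |κA|·|κB|`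
  (`RotationWords.dvd_card_of_isCliffordMixingLayer` BY NAME, no re-derivation);
* `isCliffordMixingLayer_one_iff_defect`, `isCliffordMixingLayer_pair_of_left_or_right` (ABSORPTION),
  `isCliffordMixingLayer_pair_self_iff` (THE DIAGONAL IS DEPTH TWO);
* `pow_le_four_mul_card_comm`, `pwalk_eq_self_of_comm`, `fixed_ge`, `sum_lcount2_self_ge`,
  `not_isCliffordMixingLayer_pair` — THE TRACE OBSTRUCTION: no exact pair on `n ≥ 2` wires, for ANY two families
  and budgets (incl. those passing integrality);
* `cliffStep_const`, `lstep_const`, `lcount2_const` — ONE WIRE: the string step is the letter step `lstp`;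
* `onewire_inhabitant` (with `lcount2_famAB`, `famAB_isCliffordMixingLayer`, `famBA_isCliffordMixingLayer`,
  `not_fam_isCliffordMixingLayer`, `lstep_famA_X`, `lstep_famB_Y`) — ONE WIRE, `A = {I, X, Z}` (`famA`), `B = {I, Y}`
  (`famB`): the pair IS exactly mixing (each non-identity letter reaches each non-identity letter through exactly
  `2 = 3·2/3` of the six pairs), `K_A K_B = 2J`, `D_A D_B = 0`, `D_A ≠ 0 ≠ D_B`, and NEITHER layer is exactly mixing
  alone at ANY depth `L + 1` (return counts `2 ≠ 1`, `2 ≠ 2/3`) — the configuration the i.i.d. law forbids;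
* `numbers_two` — two wires (`N = 15`): `15 ∤ 256` (the 16-letter pair fails integrality), `15 ∣ 225` (the
  15-letter pair passes it), every pair fixes `≥ 4` labels, no pair is exact.

PLACEMENT.  Fourth sub-clause of the rotation-word exactness question: `PauliRotationWordMixing` (uniform law,
divisibility), `PauliRotationLetterLawExactness` (every i.i.d. law: all-or-nothing; no-go on `n ≥ 2` by a commuting
pair; `{X, Y, Z}` on one wire), here two position-dependent layers, DECIDED: exact pairs exist iff `n = 1`, and on
one wire an exact pair need not have an exact layer.  The i.i.d. obstruction's technique class (symmetric nilpotent
⟹ zero) does not reach products of two different symmetric kernels; the trace does.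

HONEST SCOPE / DISCLOSURES.  TWO layers only: THREE or more position-dependent layers, and letter laws correlated
across positions, are NOT treated and nothing is claimed about them either way (the trace floor of `k` layers is
`4ⁿ/2ᵏ − 1` fixed non-identity labels per word, silent once `k ≥ 2n − 1`; whether deeper position-dependent letter
laws are ever exactly mixing on `n ≥ 2` wires is OPEN here).  Angle `π/2` only.  «Exact» = the `equi` count of the
interface, relative error `0`; nothing on approximate mixing rates.  No operational / diamond-norm design statement,
no state, no noise, no sampler, spoofer or test, no hardness claim; the Clifford GROUP (the exact design on paper) is
untouched.  Private plumbing re-derived rather than imported (twins of private lemmas of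
`PauliRotationLetterLawExactness` / `PauliRotationWordMixing`): `sum_nonId'`, `smul_ones_apply'`, `ones_mul_ones'`,
`ones_transpose'`, `kernel_eq_defect_add'`, `labels_pos'`, `strSign_idStr_right'`, `strSign_idStr_left'`; new private
plumbing: `sum_strSign_strSign`, `sum_strSign_right'`, `strSign_const`, `const_inj`, `table_AB`.  Nothing here
proves or refutes quantum advantage.

NEAREST PRINT.  Products of transition matrices, reversibility, stationarity: [cite: LevinPeres2017, §1.1, §1.5,
§1.6, §12.1] [cite: LyonsPeres2016, §6.2]; Pauli mixing (Definition 3): [cite: QuekEtAl2024, Methods §1.2];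
Clifford-angle rotations map strings to strings: [cite: BegusicGrayChan2024, Results §Sparse Pauli dynamics]; the
one-step rule: [cite: RudolphEtAl2025, §II B eq. (14)]; sign characters and their orthogonality: [cite:
AharonovEtAl2023, §2 (proof of Lemma 2)]; the commutation table: [cite: KempeEtAl2010, §2 Observation 4]; the
Clifford group as the exact design on paper and integrality of exact counts: [cite: ZhuEtAl2016, §1].
-/

noncomputable section

open Matrix Finset Complex

namespace Literature.Computability.QuantumComplexity

namespace PauliMixingPurity.RotationWords.LetterLaw.TwoLayer

open PauliPath PauliPropagation LocalScrambling.TransientFloor PauliMixingPurity.Witness PauliMixingPurity.Approx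
  PauliMixingPurity.RotationWords.LetterLaw

variable {ι : Type*} [Fintype ι] [DecidableEq ι]
variable {κA κB : Type*} [Fintype κA] [Fintype κB]

/-! ## 1. Two-layer letter laws: the pair ensemble, its walk, its two-step count -/

/-- The two-letter word spelled by a pair `(a, b)`: position `0` carries `A a` (acts FIRST), position `1` carries
`B b` (acts last). [cite: QuekEtAl2024, Methods §1.2] -/
def pword (A : κA → ι → Pauli) (B : κB → ι → Pauli) (p : κA × κB) : Fin 2 → ι → Pauli := ![A p.1, B p.2]

/-- The two-layer rotation ensemble `R_{A a}(π/2) R_{B b}(π/2)` indexed by `κA × κB` (`RotationWords.wordU` of the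
spelled pair). [cite: BegusicGrayChan2024, Results §Sparse Pauli dynamics] -/
def pwordU (A : κA → ι → Pauli) (B : κB → ι → Pauli) (p : κA × κB) : Matrix (ι → Bool) (ι → Bool) ℂ :=
  wordU 2 (pword A B p)

/-- The label walk of the pair: first the `A`-letter, then the `B`-letter. [cite: BegusicGrayChan2024, Results
§Sparse Pauli dynamics] -/
def pwalk (A : κA → ι → Pauli) (B : κB → ι → Pauli) (p : κA × κB) : (ι → Pauli) → ι → Pauli :=
  walk 2 (pword A B p)

omit [DecidableEq ι] [Fintype κA] [Fintype κB] in
/-- The pair walk is the composition of the two one-letter steps. [cite: RudolphEtAl2025, §II B eq. (14)] -/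
theorem pwalk_apply (A : κA → ι → Pauli) (B : κB → ι → Pauli) (p : κA × κB) (T : ι → Pauli) :
    pwalk A B p T = cliffStep (B p.2) (cliffStep (A p.1) T) := rfl

/-- **Two-step count**: the number of pairs `(a, b)` carrying `T` to `S`. [cite: QuekEtAl2024, Methods §1.2
Definition 3] -/
def lcount2 (A : κA → ι → Pauli) (B : κB → ι → Pauli) (T S : ι → Pauli) : ℝ :=
  ∑ p : κA × κB, if pwalk A B p T = S then 1 else 0

omit [DecidableEq ι] in
/-- `lcount2` is the cardinality of the fibre (the quantity `IsCliffordMixingLayer.equi` fixes).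
[cite: QuekEtAl2024, Methods §1.2 Definition 3] -/
theorem lcount2_eq_card (A : κA → ι → Pauli) (B : κB → ι → Pauli) (T S : ι → Pauli) :
    lcount2 A B T S = ((Finset.univ.filter fun p : κA × κB => pwalk A B p T = S).card : ℝ) := by
  rw [lcount2, Finset.card_filter]; push_cast; rfl

/-- **Chapman–Kolmogorov for two letter layers**: `lcount2 A B T S = Σ_U lstep A T U · lstep B U S`.
[cite: LevinPeres2017, §1.1 (t-step transition probabilities are matrix products)] -/
theorem lcount2_eq_sum (A : κA → ι → Pauli) (B : κB → ι → Pauli) (T S : ι → Pauli) :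
    lcount2 A B T S = ∑ U : ι → Pauli, lstep A T U * lstep B U S := by
  have key : ∀ a : κA, (∑ b : κB, if pwalk A B (a, b) T = S then (1 : ℝ) else 0) =
      ∑ U : ι → Pauli, (if cliffStep (A a) T = U then (1 : ℝ) else 0) * lstep B U S := by
    intro a
    simp only [ite_mul, one_mul, zero_mul]
    rw [Finset.sum_ite_eq Finset.univ (cliffStep (A a) T), if_pos (Finset.mem_univ _)]
    rfl
  calc lcount2 A B T S = ∑ a : κA, ∑ b : κB, (if pwalk A B (a, b) T = S then (1 : ℝ) else 0) :=
        Fintype.sum_prod_type _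
    _ = ∑ a : κA, ∑ U : ι → Pauli, (if cliffStep (A a) T = U then (1 : ℝ) else 0) * lstep B U S := by
        simp only [key]
    _ = ∑ U : ι → Pauli, ∑ a : κA, (if cliffStep (A a) T = U then (1 : ℝ) else 0) * lstep B U S :=
        Finset.sum_comm
    _ = ∑ U : ι → Pauli, lstep A T U * lstep B U S := by
        simp only [← Finset.sum_mul]; rfl

/-- Sums over non-identity labels: total minus the identity term (twin of the private `LetterLaw.sum_nonId`).
[folklore] -/
private theorem sum_nonId' (f : (ι → Pauli) → ℝ) :
    ∑ V : {S : ι → Pauli // S ≠ idStr}, f V.1 = (∑ V, f V) - f idStr := by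
  rw [← Finset.sum_erase_eq_sub (f := f) (Finset.mem_univ idStr)]
  exact (Finset.sum_subtype (Finset.univ.erase idStr) (fun V => by simp) f).symm

/-- **Two-step counts are the kernel product**: `(K_A K_B)_{U S} = lcount2 A B U S` on non-identity labels (the
identity label is isolated). [cite: LevinPeres2017, §1.1] [cite: QuekEtAl2024, Methods §1.2 Definition 3] -/
theorem kernel_mul_kernel_apply (A : κA → ι → Pauli) (B : κB → ι → Pauli) (U S : {S : ι → Pauli // S ≠ idStr}) :
    (kernel A * kernel B) U S = lcount2 A B U.1 S.1 := by
  rw [Matrix.mul_apply, lcount2_eq_sum]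
  simp only [kernel, Matrix.of_apply]
  have h := sum_nonId' (ι := ι) fun V => lstep A U.1 V * lstep B V S.1
  rw [h, lstep_idStr_right A U.2, zero_mul, sub_zero]

/-! ## 2. Kernel algebra of two families: `K_A K_B = D_A D_B + (|κA||κB|/N) J` -/

omit [Fintype ι] [DecidableEq ι] in
/-- Entries of `c · J`. [folklore] -/
private theorem smul_ones_apply' (c : ℝ) (U S : {S : ι → Pauli // S ≠ idStr}) :
    (c • (ones : Matrix {S : ι → Pauli // S ≠ idStr} {S : ι → Pauli // S ≠ idStr} ℝ)) U S = c := by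
  rw [Matrix.smul_apply, ones, Matrix.of_apply, smul_eq_mul, mul_one]

/-- `J J = (4ⁿ − 1) J`. [folklore] -/
private theorem ones_mul_ones' :
    (ones : Matrix {S : ι → Pauli // S ≠ idStr} {S : ι → Pauli // S ≠ idStr} ℝ) * ones =
      ((4 : ℝ) ^ Fintype.card ι - 1) • ones := by
  ext U S
  rw [Matrix.mul_apply, smul_ones_apply']
  simp only [ones, Matrix.of_apply, mul_one, Finset.sum_const, Finset.card_univ, nsmul_eq_mul, card_nonId]

omit [Fintype ι] [DecidableEq ι] in
/-- `Jᵀ = J`. [folklore] -/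
private theorem ones_transpose' :
    (ones : Matrix {S : ι → Pauli // S ≠ idStr} {S : ι → Pauli // S ≠ idStr} ℝ)ᵀ = ones := rfl

omit [DecidableEq ι] in
/-- `K = D + cJ`. [folklore] -/
private theorem kernel_eq_defect_add' {κ : Type*} [Fintype κ] (P : κ → ι → Pauli) :
    kernel P = defect P + ((Fintype.card κ : ℝ) / ((4 : ℝ) ^ Fintype.card ι - 1)) • ones :=
  (sub_add_cancel _ _).symm

omit [DecidableEq ι] in
/-- `4ⁿ − 1 > 0` on `n ≥ 1` wires. [folklore] -/
private theorem labels_pos' [Nonempty ι] : 0 < (4 : ℝ) ^ Fintype.card ι - 1 :=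
  sub_pos.mpr (one_lt_pow₀ (by norm_num) Fintype.card_ne_zero)

/-- **The cross terms die for TWO families as well**: `K_A K_B = D_A D_B + (|κA|·|κB|/(4ⁿ − 1)) J`, because
`D_A J = 0 = J D_B` (`LetterLaw.defect_mul_ones`, `ones_mul_defect` BY NAME). [cite: LevinPeres2017, §12.1] -/
theorem kernel_mul_kernel [Nonempty ι] (A : κA → ι → Pauli) (B : κB → ι → Pauli) :
    kernel A * kernel B = defect A * defect B +
      ((Fintype.card κA : ℝ) * Fintype.card κB / ((4 : ℝ) ^ Fintype.card ι - 1)) • ones := by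
  have hN : (4 : ℝ) ^ Fintype.card ι - 1 ≠ 0 := (labels_pos' (ι := ι)).ne'
  set a : ℝ := (Fintype.card κA : ℝ) / ((4 : ℝ) ^ Fintype.card ι - 1) with ha
  set b : ℝ := (Fintype.card κB : ℝ) / ((4 : ℝ) ^ Fintype.card ι - 1) with hb
  have hAJ : defect A * (b • ones) = 0 := by rw [Matrix.mul_smul, defect_mul_ones, smul_zero]
  have hJB : (a • ones) * defect B = 0 := by rw [Matrix.smul_mul, ones_mul_defect, smul_zero]
  have hJJ : (a • (ones : Matrix {S : ι → Pauli // S ≠ idStr} {S : ι → Pauli // S ≠ idStr} ℝ)) * (b • ones) =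
      (a * b * ((4 : ℝ) ^ Fintype.card ι - 1)) • ones := by
    rw [Matrix.smul_mul, Matrix.mul_smul, ones_mul_ones', smul_smul, smul_smul]
  have hcoef : a * b * ((4 : ℝ) ^ Fintype.card ι - 1) =
      (Fintype.card κA : ℝ) * Fintype.card κB / ((4 : ℝ) ^ Fintype.card ι - 1) := by
    rw [ha, hb]; field_simp
  rw [kernel_eq_defect_add' A, kernel_eq_defect_add' B, Matrix.add_mul, Matrix.mul_add, Matrix.mul_add, hAJ, hJB,
    hJJ, add_zero, zero_add, hcoef]

/-- **FLATNESS CRITERION**: `K_A K_B` is flat iff `D_A D_B = 0`. [cite: LevinPeres2017, §12.1] -/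
theorem kernel_mul_kernel_eq_iff [Nonempty ι] (A : κA → ι → Pauli) (B : κB → ι → Pauli) :
    kernel A * kernel B = ((Fintype.card κA : ℝ) * Fintype.card κB / ((4 : ℝ) ^ Fintype.card ι - 1)) • ones ↔
      defect A * defect B = 0 := by
  rw [kernel_mul_kernel]
  constructor
  · intro h; exact add_right_cancel (h.trans (zero_add _).symm)
  · intro h; rw [h, zero_add]

/-- **Order reversal is transposition**: `(K_A K_B)ᵀ = K_B K_A` (each kernel is symmetric, `LetterLaw.kernel_transpose`).
[cite: LevinPeres2017, §1.6 (reversibility)] -/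
theorem transpose_kernel_mul_kernel (A : κA → ι → Pauli) (B : κB → ι → Pauli) :
    (kernel A * kernel B)ᵀ = kernel B * kernel A := by
  rw [Matrix.transpose_mul, kernel_transpose, kernel_transpose]

/-- **ORDER SYMMETRY of flatness**: `K_A K_B` is flat iff `K_B K_A` is. [cite: LevinPeres2017, §1.6] -/
theorem kernel_mul_kernel_flat_comm (A : κA → ι → Pauli) (B : κB → ι → Pauli) (c : ℝ) :
    kernel A * kernel B = c • ones ↔ kernel B * kernel A = c • ones := by
  constructor
  · intro h; rw [← transpose_kernel_mul_kernel, h, Matrix.transpose_smul, ones_transpose']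
  · intro h; rw [← transpose_kernel_mul_kernel, h, Matrix.transpose_smul, ones_transpose']

/-! ## 3. Bridge to the interface `IsCliffordMixingLayer` -/

/-- The interface for the pair ensemble ⟺ every two-step count is `|κA||κB|/(4ⁿ − 1)` (unitarity, Clifford
conjugation and non-identity hold for every word, `RotationWords.wordU_mul_conjTranspose` / `wordU_conj` /
`walk_ne_idStr` BY NAME). [cite: QuekEtAl2024, Methods §1.2 Definition 3] -/
theorem isCliffordMixingLayer_pair_iff (A : κA → ι → Pauli) (B : κB → ι → Pauli) :
    IsCliffordMixingLayer (pwordU A B) (pwalk A B) ↔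
      ∀ S T : ι → Pauli, S ≠ idStr → T ≠ idStr →
        lcount2 A B T S = (Fintype.card κA : ℝ) * Fintype.card κB / ((4 : ℝ) ^ Fintype.card ι - 1) := by
  have hcard : (Fintype.card (κA × κB) : ℝ) = (Fintype.card κA : ℝ) * Fintype.card κB := by
    rw [Fintype.card_prod, Nat.cast_mul]
  constructor
  · intro h S T hS hT
    rw [lcount2_eq_card, h.equi S T hS hT, hcard]
  · intro h
    exact
      { unitary := fun p => wordU_mul_conjTranspose 2 (pword A B p)
        conj := fun p T => ⟨wordPhase 2 (pword A B p) T, norm_wordPhase 2 _ T, wordU_conj 2 _ T⟩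
        nonId := fun p T hT => walk_ne_idStr 2 _ hT
        equi := fun S T hS hT => by rw [← lcount2_eq_card, h S T hS hT, hcard] }

/-- The interface ⟺ a flat kernel product. [cite: QuekEtAl2024, Methods §1.2 Definition 3] [cite: LevinPeres2017, §1.1] -/
theorem isCliffordMixingLayer_pair_iff_kernel (A : κA → ι → Pauli) (B : κB → ι → Pauli) :
    IsCliffordMixingLayer (pwordU A B) (pwalk A B) ↔
      kernel A * kernel B = ((Fintype.card κA : ℝ) * Fintype.card κB / ((4 : ℝ) ^ Fintype.card ι - 1)) • ones := by
  rw [isCliffordMixingLayer_pair_iff]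
  constructor
  · intro h; ext U S; rw [kernel_mul_kernel_apply, smul_ones_apply']; exact h S.1 U.1 S.2 U.2
  · intro h S T hS hT
    have h' := congrFun (congrFun h ⟨T, hT⟩) ⟨S, hS⟩
    rwa [kernel_mul_kernel_apply, smul_ones_apply'] at h'

/-- **THE TWO-LAYER CRITERION** (`n ≥ 1` wires): the two-layer letter law «a letter from `A`, then a letter from `B`»
is exactly Clifford–Pauli mixing iff the DEFECTS MULTIPLY TO ZERO, `D_A D_B = 0`.  For `B = A` this is
`LetterLaw.isCliffordMixingLayer_iff_depth_one` at depth two (`D² = 0 ⟺ D = 0`); for `A ≠ B` the two symmetric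
defects are distinct and the nilpotent descent is gone. [cite: LevinPeres2017, §12.1] [cite: QuekEtAl2024, Methods
§1.2 Definition 3] -/
theorem isCliffordMixingLayer_pair_iff_defect [Nonempty ι] (A : κA → ι → Pauli) (B : κB → ι → Pauli) :
    IsCliffordMixingLayer (pwordU A B) (pwalk A B) ↔ defect A * defect B = 0 := by
  rw [isCliffordMixingLayer_pair_iff_kernel, kernel_mul_kernel_eq_iff]

/-- **ORDER SYMMETRY**: «`A` then `B`» is exactly mixing iff «`B` then `A`» is. [cite: LevinPeres2017, §1.6
(reversibility)] [cite: QuekEtAl2024, Methods §1.2 Definition 3] -/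
theorem isCliffordMixingLayer_pair_comm (A : κA → ι → Pauli) (B : κB → ι → Pauli) :
    IsCliffordMixingLayer (pwordU A B) (pwalk A B) ↔ IsCliffordMixingLayer (pwordU B A) (pwalk B A) := by
  rw [isCliffordMixingLayer_pair_iff_kernel, isCliffordMixingLayer_pair_iff_kernel, kernel_mul_kernel_flat_comm,
    mul_comm (Fintype.card κA : ℝ)]

/-! ## 4. Integrality; one layer vs. the pair; the diagonal -/

/-- **INTEGRALITY**: an exactly mixing two-layer letter law on `n ≥ 1` wires has `(4ⁿ − 1) ∣ |κA|·|κB|`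
(`RotationWords.dvd_card_of_isCliffordMixingLayer` BY NAME on the index type `κA × κB`). [cite: ZhuEtAl2016, §1]
[cite: QuekEtAl2024, Methods §1.2 Definition 3] -/
theorem dvd_of_isCliffordMixingLayer_pair [Nonempty ι] {A : κA → ι → Pauli} {B : κB → ι → Pauli}
    (h : IsCliffordMixingLayer (pwordU A B) (pwalk A B)) :
    (4 ^ Fintype.card ι - 1) ∣ Fintype.card κA * Fintype.card κB := by
  have hT : (fun _ : ι => Pauli.X) ≠ (idStr : ι → Pauli) := fun h => by
    have := congrFun h (Classical.arbitrary ι); exact Pauli.noConfusion this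
  have hd := dvd_card_of_isCliffordMixingLayer h hT
  rwa [Fintype.card_prod] at hd

/-- **DEPTH ONE ⟺ ZERO DEFECT**: a single letter layer is exactly mixing iff `D = 0` (so the two-layer criterion
`D_A D_B = 0` sits strictly below «`A` or `B` exact alone»: absorption below; that the gap is inhabited is § 7).
[cite: LevinPeres2017, §12.1] [cite: QuekEtAl2024, Methods §1.2 Definition 3] -/
theorem isCliffordMixingLayer_one_iff_defect {κ : Type*} [Fintype κ] (P : κ → ι → Pauli) :
    IsCliffordMixingLayer (lwordU P 1) (lwalk P 1) ↔ defect P = 0 := by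
  rw [isCliffordMixingLayer_iff_lcount, lcount_const_iff_kernel_pow, pow_one, pow_one, defect, sub_eq_zero]

/-- **ABSORPTION (sufficient condition)**: if ONE layer alone is exactly mixing (`D = 0`) then so is the pair,
whatever the other layer. [cite: LevinPeres2017, §1.5 (stationarity is preserved)] [cite: QuekEtAl2024, Methods
§1.2 Definition 3] -/
theorem isCliffordMixingLayer_pair_of_left_or_right [Nonempty ι] {A : κA → ι → Pauli} {B : κB → ι → Pauli}
    (h : IsCliffordMixingLayer (lwordU A 1) (lwalk A 1) ∨ IsCliffordMixingLayer (lwordU B 1) (lwalk B 1)) :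
    IsCliffordMixingLayer (pwordU A B) (pwalk A B) := by
  rw [isCliffordMixingLayer_pair_iff_defect]
  rcases h with h | h
  · rw [(isCliffordMixingLayer_one_iff_defect A).mp h, zero_mul]
  · rw [(isCliffordMixingLayer_one_iff_defect B).mp h, mul_zero]

/-- **THE DIAGONAL IS DEPTH TWO**: the pair `(P, P)` is exactly mixing iff `P` is at depth one — the `L = 1` instance
of `LetterLaw.kernel_pow_eq_iff` (`K² flat ⟺ K flat`), i.e. of the all-or-nothing law. [cite: LevinPeres2017, §12.1]
[cite: QuekEtAl2024, Methods §1.2 Definition 3] -/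
theorem isCliffordMixingLayer_pair_self_iff [Nonempty ι] {κ : Type*} [Fintype κ] (P : κ → ι → Pauli) :
    IsCliffordMixingLayer (pwordU P P) (pwalk P P) ↔ IsCliffordMixingLayer (lwordU P 1) (lwalk P 1) := by
  have hsq : kernel P ^ (1 + 1) = kernel P * kernel P := by rw [pow_succ, pow_one]
  have hc : (Fintype.card κ : ℝ) ^ (1 + 1) = (Fintype.card κ : ℝ) * Fintype.card κ := by rw [pow_succ, pow_one]
  rw [isCliffordMixingLayer_pair_iff_kernel, isCliffordMixingLayer_one_iff_defect, ← hsq, ← hc, kernel_pow_eq_iff,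
    defect, sub_eq_zero]

/-! ## 5. NO exact pair on `n ≥ 2` wires: the trace (common-commutant) obstruction -/

omit [DecidableEq ι] in
/-- `s_U(I) = 1`. [cite: KempeEtAl2010, §2 Observation 4] -/
private theorem strSign_idStr_right' (U : ι → Pauli) : strSign U idStr = 1 := by
  unfold strSign; exact Finset.prod_eq_one fun i _ => by cases U i <;> rfl

omit [DecidableEq ι] in
/-- `s_I(U) = 1`. [cite: KempeEtAl2010, §2 Observation 4] -/
private theorem strSign_idStr_left' (U : ι → Pauli) : strSign idStr U = 1 := by
  unfold strSign; exact Finset.prod_eq_one fun i _ => by cases U i <;> rfl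

/-- Character orthogonality in the `(a, U)` orientation: `Σ_U s_a(U) s_b(U) = 4ⁿ [a = b]`
(`PauliPath.sum_strSign_mul_strSign` BY NAME + symmetry of the sign). [cite: AharonovEtAl2023, §2 (proof of Lemma 2)] -/
private theorem sum_strSign_strSign (a b : ι → Pauli) :
    ∑ U : ι → Pauli, strSign a U * strSign b U = if a = b then (4 : ℂ) ^ Fintype.card ι else 0 := by
  rw [← sum_strSign_mul_strSign a b]
  exact Finset.sum_congr rfl fun U _ => by rw [OTOC.strSign_comm a U, OTOC.strSign_comm b U]

/-- `Σ_U s_a(U) = 4ⁿ [a = I]`. [cite: AharonovEtAl2023, §2 (proof of Lemma 2)] -/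
private theorem sum_strSign_right' (a : ι → Pauli) :
    ∑ U : ι → Pauli, strSign a U = if a = idStr then (4 : ℂ) ^ Fintype.card ι else 0 := by
  rw [← sum_strSign_strSign a idStr]
  exact Finset.sum_congr rfl fun U _ => by rw [strSign_idStr_left', mul_one]

/-- **THE COMMON COMMUTANT IS LARGE**: at least `4ⁿ/4` labels (identity included) commute with BOTH `a` and `b` —
`4·#{U : s_a(U) = s_b(U) = 1} = Σ_U (1 + s_a(U))(1 + s_b(U)) = 4ⁿ(1 + [a = I] + [b = I] + [a = b])`.
[cite: AharonovEtAl2023, §2 (proof of Lemma 2)] [cite: KempeEtAl2010, §2 Observation 4] -/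
theorem pow_le_four_mul_card_comm (a b : ι → Pauli) :
    4 ^ Fintype.card ι ≤ 4 * (Finset.univ.filter fun U : ι → Pauli => strSign a U = 1 ∧ strSign b U = 1).card := by
  have hterm : ∀ U : ι → Pauli, (4 : ℂ) * (if strSign a U = 1 ∧ strSign b U = 1 then (1 : ℂ) else 0) =
      1 + strSign a U + (strSign b U + strSign a U * strSign b U) := by
    intro U
    rcases OTOC.strSign_eq_one_or a U with ha | ha <;> rcases OTOC.strSign_eq_one_or b U with hb | hb <;>
      rw [ha, hb] <;> norm_num
  have hcard : ((Finset.univ.filter fun U : ι → Pauli => strSign a U = 1 ∧ strSign b U = 1).card : ℂ) =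
      ∑ U : ι → Pauli, if strSign a U = 1 ∧ strSign b U = 1 then (1 : ℂ) else 0 := by
    rw [Finset.card_filter]; push_cast; rfl
  have hC : (4 : ℂ) * ((Finset.univ.filter fun U : ι → Pauli => strSign a U = 1 ∧ strSign b U = 1).card : ℂ) =
      (4 : ℂ) ^ Fintype.card ι + (if a = idStr then (4 : ℂ) ^ Fintype.card ι else 0) +
        ((if b = idStr then (4 : ℂ) ^ Fintype.card ι else 0) + if a = b then (4 : ℂ) ^ Fintype.card ι else 0) := by
    rw [hcard, Finset.mul_sum, Finset.sum_congr rfl fun U _ => hterm U, Finset.sum_add_distrib, Finset.sum_add_distrib,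
      Finset.sum_add_distrib, sum_strSign_right', sum_strSign_right', sum_strSign_strSign, Finset.sum_const,
      Finset.card_univ, Fintype.card_fun, Pauli.card_univ, nsmul_eq_mul, mul_one]
    push_cast; rfl
  have hnat : ((4 * (Finset.univ.filter fun U : ι → Pauli => strSign a U = 1 ∧ strSign b U = 1).card : ℕ) : ℂ) =
      ((4 ^ Fintype.card ι + (if a = idStr then 4 ^ Fintype.card ι else 0) +
        ((if b = idStr then 4 ^ Fintype.card ι else 0) + if a = b then 4 ^ Fintype.card ι else 0) : ℕ) : ℂ) := by
    push_cast; exact hC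
  have h := Nat.cast_injective hnat
  calc 4 ^ Fintype.card ι ≤ 4 ^ Fintype.card ι + (if a = idStr then 4 ^ Fintype.card ι else 0) +
        ((if b = idStr then 4 ^ Fintype.card ι else 0) + if a = b then 4 ^ Fintype.card ι else 0) :=
      (Nat.le_add_right _ _).trans (Nat.le_add_right _ _)
    _ = _ := h.symm

omit [DecidableEq ι] [Fintype κA] [Fintype κB] in
/-- A label commuting with both letters is FIXED by the pair step. [cite: RudolphEtAl2025, §II B eq. (14)] -/
theorem pwalk_eq_self_of_comm (A : κA → ι → Pauli) (B : κB → ι → Pauli) (p : κA × κB) {U : ι → Pauli}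
    (ha : strSign (A p.1) U = 1) (hb : strSign (B p.2) U = 1) : pwalk A B p U = U := by
  have h1 : cliffStep (A p.1) U = U := by rw [cliffStep, if_pos ha]
  rw [pwalk_apply, h1, cliffStep, if_pos hb]

omit [Fintype κA] [Fintype κB] in
/-- **EVERY PAIR FIXES AT LEAST `4ⁿ/4` LABELS** (identity included). [cite: RudolphEtAl2025, §II B eq. (14)]
[cite: AharonovEtAl2023, §2 (proof of Lemma 2)] -/
theorem fixed_ge (A : κA → ι → Pauli) (B : κB → ι → Pauli) (p : κA × κB) :
    (4 : ℝ) ^ Fintype.card ι / 4 ≤ ∑ U : ι → Pauli, if pwalk A B p U = U then (1 : ℝ) else 0 := by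
  have hsub : (Finset.univ.filter fun U : ι → Pauli => strSign (A p.1) U = 1 ∧ strSign (B p.2) U = 1) ⊆
      Finset.univ.filter fun U : ι → Pauli => pwalk A B p U = U := by
    intro U hU
    simp only [Finset.mem_filter, Finset.mem_univ, true_and] at hU ⊢
    exact pwalk_eq_self_of_comm A B p hU.1 hU.2
  have hc := Finset.card_le_card hsub
  have h4 := pow_le_four_mul_card_comm (A p.1) (B p.2)
  have hsum : (∑ U : ι → Pauli, if pwalk A B p U = U then (1 : ℝ) else 0) =
      ((Finset.univ.filter fun U : ι → Pauli => pwalk A B p U = U).card : ℝ) := by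
    rw [Finset.card_filter]; push_cast; rfl
  rw [hsum]
  have h : ((4 ^ Fintype.card ι : ℕ) : ℝ) ≤
      ((4 * (Finset.univ.filter fun U : ι → Pauli => pwalk A B p U = U).card : ℕ) : ℝ) := by
    exact_mod_cast h4.trans (Nat.mul_le_mul_left 4 hc)
  push_cast at h
  linarith

/-- **TRACE FLOOR**: `Σ_{U ≠ I} lcount2 A B U U ≥ |κA|·|κB|·(4ⁿ/4 − 1)` — the trace of `K_A K_B` counts, pair by
pair, the non-identity labels it fixes. [cite: LevinPeres2017, §1.1] [cite: RudolphEtAl2025, §II B eq. (14)] -/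
theorem sum_lcount2_self_ge (A : κA → ι → Pauli) (B : κB → ι → Pauli) :
    (Fintype.card κA : ℝ) * Fintype.card κB * ((4 : ℝ) ^ Fintype.card ι / 4 - 1) ≤
      ∑ U : {S : ι → Pauli // S ≠ idStr}, lcount2 A B U.1 U.1 := by
  have hid : lcount2 A B idStr idStr = (Fintype.card κA : ℝ) * Fintype.card κB := by
    unfold lcount2
    rw [Finset.sum_congr rfl fun p _ =>
        if_pos (pwalk_eq_self_of_comm A B p (strSign_idStr_right' _) (strSign_idStr_right' _)),
      Finset.sum_const, Finset.card_univ, Fintype.card_prod, nsmul_eq_mul, mul_one, Nat.cast_mul]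
  have hswap : ∑ U : ι → Pauli, lcount2 A B U U =
      ∑ p : κA × κB, ∑ U : ι → Pauli, if pwalk A B p U = U then (1 : ℝ) else 0 := by
    unfold lcount2; exact Finset.sum_comm
  have hge : ∑ _p : κA × κB, (4 : ℝ) ^ Fintype.card ι / 4 ≤
      ∑ p : κA × κB, ∑ U : ι → Pauli, if pwalk A B p U = U then (1 : ℝ) else 0 :=
    Finset.sum_le_sum fun p _ => fixed_ge A B p
  rw [Finset.sum_const, Finset.card_univ, Fintype.card_prod, nsmul_eq_mul, Nat.cast_mul] at hge
  rw [sum_nonId' fun U => lcount2 A B U U, hid, hswap]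
  linarith

/-- **NO TWO-LAYER LETTER LAW IS EXACTLY MIXING ON `n ≥ 2` WIRES** (any two families, any budgets — incl. those
with `(4ⁿ − 1) ∣ |κA||κB|`, where integrality is silent): exactness makes every diagonal count `|κA||κB|/(4ⁿ − 1)`,
so the trace is `|κA||κB|` (one fixed non-identity label per pair ON AVERAGE), while every pair fixes at least
`4ⁿ/4 − 1 ≥ 3` of them.  With § 7: an exactly mixing two-layer letter law exists iff `n = 1`.  HONEST SCOPE: two
layers; three or more layers NOT treated. [cite: QuekEtAl2024, Methods §1.2 Definition 3] [cite: ZhuEtAl2016, §1]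
[cite: LevinPeres2017, §12.1] -/
theorem not_isCliffordMixingLayer_pair (hn : 1 < Fintype.card ι) [Nonempty κA] [Nonempty κB]
    (A : κA → ι → Pauli) (B : κB → ι → Pauli) : ¬ IsCliffordMixingLayer (pwordU A B) (pwalk A B) := by
  haveI : Nonempty ι := Fintype.card_pos_iff.mp (by omega)
  have hN : (4 : ℝ) ^ Fintype.card ι - 1 ≠ 0 := (labels_pos' (ι := ι)).ne'
  intro h
  have hc := (isCliffordMixingLayer_pair_iff A B).mp h
  have hsum : ∑ U : {S : ι → Pauli // S ≠ idStr}, lcount2 A B U.1 U.1 = (Fintype.card κA : ℝ) * Fintype.card κB := by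
    rw [Finset.sum_congr rfl fun U _ => hc U.1 U.1 U.2 U.2, Finset.sum_const, Finset.card_univ, nsmul_eq_mul,
      card_nonId, mul_div_assoc', mul_div_cancel_left₀ _ hN]
  have hge := sum_lcount2_self_ge A B
  rw [hsum] at hge
  have hk : (1 : ℝ) ≤ (Fintype.card κA : ℝ) * Fintype.card κB := by
    have hA : 1 ≤ Fintype.card κA := Fintype.card_pos
    have hB : 1 ≤ Fintype.card κB := Fintype.card_pos
    exact_mod_cast Nat.mul_le_mul hA hB
  have h16 : (16 : ℝ) ≤ (4 : ℝ) ^ Fintype.card ι := by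
    have h := pow_le_pow_right₀ (show (1 : ℝ) ≤ 4 by norm_num) hn
    norm_num at h
    exact h
  have hk0 : (0 : ℝ) ≤ (Fintype.card κA : ℝ) * Fintype.card κB := by positivity
  have hmul : (Fintype.card κA : ℝ) * Fintype.card κB * 16 ≤
      (Fintype.card κA : ℝ) * Fintype.card κB * (4 : ℝ) ^ Fintype.card ι := mul_le_mul_of_nonneg_left h16 hk0
  nlinarith

/-! ## 6. One wire: the letter-level step -/

/-- The ONE-WIRE letter step `u ↦ x ▸ u`: `u` if `x, u` commute (`x = I`, `u = I` or `x = u`), the product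
letter `x·u` otherwise. [cite: RudolphEtAl2025, §II B eq. (14)] [cite: KempeEtAl2010, §2 Observation 4] -/
def lstp (x u : Pauli) : Pauli := if x = Pauli.I ∨ u = Pauli.I ∨ x = u then u else Pauli.letterMul x u

omit [DecidableEq ι] in
/-- On one wire the sign character of two constant strings is the letter sign. [cite: KempeEtAl2010, §2
Observation 4] -/
private theorem strSign_const (h1 : Fintype.card ι = 1) (x u : Pauli) :
    strSign (fun _ : ι => x) (fun _ : ι => u) = Pauli.sign x u := by
  rw [strSign_eq, Finset.prod_const, Finset.card_univ, h1, pow_one]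

omit [DecidableEq ι] in
/-- On one wire `cliffStep` IS the letter step. [cite: RudolphEtAl2025, §II B eq. (14)] -/
theorem cliffStep_const (h1 : Fintype.card ι = 1) (x u : Pauli) :
    cliffStep (fun _ : ι => x) (fun _ : ι => u) = fun _ => lstp x u := by
  by_cases h : x = Pauli.I ∨ u = Pauli.I ∨ x = u
  · have hs : Pauli.sign x u = 1 := if_pos h
    rw [cliffStep, strSign_const h1, if_pos hs]
    funext i
    rw [lstp, if_pos h]
  · have hs : Pauli.sign x u ≠ 1 := by rw [Pauli.sign, if_neg h]; norm_num
    rw [cliffStep, strSign_const h1, if_neg hs]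
    funext i
    rw [lstp, if_neg h]
    rfl

omit [Fintype ι] [DecidableEq ι] in
/-- Constant strings are equal iff their letters are. [folklore] -/
private theorem const_inj [Nonempty ι] {a b : Pauli} : ((fun _ : ι => a) = fun _ => b) ↔ a = b :=
  ⟨fun h => congrFun h (Classical.arbitrary ι), fun h => h ▸ rfl⟩

omit [DecidableEq ι] in
/-- **ONE-WIRE READING of the one-step count**: a letter count. [cite: RudolphEtAl2025, §II B eq. (14)]
[cite: QuekEtAl2024, Methods §1.2 Definition 3] -/
theorem lstep_const (h1 : Fintype.card ι = 1) {κ : Type*} [Fintype κ] (α : κ → Pauli) (u s : Pauli) :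
    lstep (fun a (_ : ι) => α a) (fun _ => u) (fun _ => s) = ∑ a : κ, if lstp (α a) u = s then (1 : ℝ) else 0 := by
  haveI : Nonempty ι := Fintype.card_pos_iff.mp (by omega)
  unfold lstep
  refine Finset.sum_congr rfl fun a _ => if_congr ?_ rfl rfl
  rw [cliffStep_const h1]
  exact const_inj

omit [DecidableEq ι] in
/-- **ONE-WIRE READING of the two-step count**: a two-letter count. [cite: RudolphEtAl2025, §II B eq. (14)]
[cite: QuekEtAl2024, Methods §1.2 Definition 3] -/
theorem lcount2_const (h1 : Fintype.card ι = 1) (α : κA → Pauli) (β : κB → Pauli) (t s : Pauli) :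
    lcount2 (fun a (_ : ι) => α a) (fun b _ => β b) (fun _ => t) (fun _ => s) =
      ∑ p : κA × κB, if lstp (β p.2) (lstp (α p.1) t) = s then (1 : ℝ) else 0 := by
  haveI : Nonempty ι := Fintype.card_pos_iff.mp (by omega)
  unfold lcount2
  refine Finset.sum_congr rfl fun p _ => if_congr ?_ rfl rfl
  rw [pwalk_apply, cliffStep_const h1, cliffStep_const h1]
  exact const_inj

/-! ## 7. THE ONE-WIRE INHABITANT: `A = {I, X, Z}` then `B = {I, Y}` -/

/-- Layer `A`: the one-wire strings with letters `I, X, Z` (budget `|κA| = 3`). [cite: RudolphEtAl2025, §II B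
eq. (14)] -/
def famA : Fin 3 → ι → Pauli := fun k _ => ![Pauli.I, Pauli.X, Pauli.Z] k

/-- Layer `B`: the one-wire strings with letters `I, Y` (budget `|κB| = 2`). [cite: RudolphEtAl2025, §II B eq. (14)] -/
def famB : Fin 2 → ι → Pauli := fun k _ => ![Pauli.I, Pauli.Y] k

/-- The `3 × 3` letter table of the pair: EVERY non-identity letter reaches every non-identity letter through
EXACTLY `2 = 3·2/3` of the six pairs (`X ↦ {X,X,Y} ↦ {X,Z,X,Z,Y,Y}`, `Y ↦ {Y,Z,X} ↦ {Y,Y,Z,X,X,Z}`,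
`Z ↦ {Z,Y,Z} ↦ {Z,X,Y,Y,Z,X}`). [cite: KempeEtAl2010, §2 Observation 4 (commutation table)] -/
private theorem table_AB {t s : Pauli} (ht : t ≠ Pauli.I) (hs : s ≠ Pauli.I) :
    (∑ p : Fin 3 × Fin 2,
        if lstp (![Pauli.I, Pauli.Y] p.2) (lstp (![Pauli.I, Pauli.X, Pauli.Z] p.1) t) = s then (1 : ℝ) else 0) = 2 := by
  rw [Fintype.sum_prod_type, Fin.sum_univ_three]
  simp only [Fin.sum_univ_two]
  cases t <;> cases s <;> simp_all [lstp, Pauli.letterMul] <;> norm_num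

omit [DecidableEq ι] in
/-- **EVERY TWO-STEP COUNT OF THE PAIR IS `2`** on one wire. [cite: QuekEtAl2024, Methods §1.2 Definition 3]
[cite: RudolphEtAl2025, §II B eq. (14)] -/
theorem lcount2_famAB (h1 : Fintype.card ι = 1) {T S : ι → Pauli} (hT : T ≠ idStr) (hS : S ≠ idStr) :
    lcount2 (famA (ι := ι)) famB T S = 2 := by
  obtain ⟨i₀, hi₀⟩ := Fintype.card_eq_one_iff.mp h1
  have hfun : ∀ V : ι → Pauli, V = fun _ => V i₀ := fun V => funext fun i => by rw [hi₀ i]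
  have hT0 : T i₀ ≠ Pauli.I := fun h => hT ((hfun T).trans (funext fun _ => h))
  have hS0 : S i₀ ≠ Pauli.I := fun h => hS ((hfun S).trans (funext fun _ => h))
  rw [hfun T, hfun S]
  unfold famA famB
  rw [lcount2_const h1]
  exact table_AB hT0 hS0

/-- **THE PAIR IS EXACTLY MIXING** on one wire: `lcount2 = 2 = |κA||κB|/(4¹ − 1)`. [cite: QuekEtAl2024, Methods
§1.2 Definition 3] [cite: RudolphEtAl2025, §II B eq. (14)] -/
theorem famAB_isCliffordMixingLayer (h1 : Fintype.card ι = 1) :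
    IsCliffordMixingLayer (pwordU (famA (ι := ι)) famB) (pwalk famA famB) := by
  rw [isCliffordMixingLayer_pair_iff]
  intro S T hS hT
  rw [lcount2_famAB h1 hT hS, Fintype.card_fin, Fintype.card_fin, h1]
  norm_num

/-- … and so is the reversed pair «`B` then `A`» (order symmetry). [cite: QuekEtAl2024, Methods §1.2 Definition 3]
[cite: LevinPeres2017, §1.6] -/
theorem famBA_isCliffordMixingLayer (h1 : Fintype.card ι = 1) :
    IsCliffordMixingLayer (pwordU (famB (ι := ι)) famA) (pwalk famB famA) :=
  (isCliffordMixingLayer_pair_comm famA famB).mp (famAB_isCliffordMixingLayer h1)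

omit [DecidableEq ι] in
/-- Layer `A` alone: `X` returns to `X` through `2` of its `3` letters (`I`, `X`), not `1 = 3/3`.
[cite: RudolphEtAl2025, §II B eq. (14)] -/
theorem lstep_famA_X (h1 : Fintype.card ι = 1) :
    lstep (famA (ι := ι)) (fun _ => Pauli.X) (fun _ => Pauli.X) = 2 := by
  unfold famA
  rw [lstep_const h1, Fin.sum_univ_three]
  simp [lstp, Pauli.letterMul]
  norm_num

omit [DecidableEq ι] in
/-- Layer `B` alone: `Y` returns to `Y` through both of its letters, `2 ≠ 2/3`. [cite: RudolphEtAl2025, §II B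
eq. (14)] -/
theorem lstep_famB_Y (h1 : Fintype.card ι = 1) :
    lstep (famB (ι := ι)) (fun _ => Pauli.Y) (fun _ => Pauli.Y) = 2 := by
  unfold famB
  rw [lstep_const h1, Fin.sum_univ_two]
  simp [lstp]
  norm_num

/-- **NEITHER LAYER IS EXACTLY MIXING ALONE, AT ANY DEPTH `L + 1`** (all-or-nothing BY NAME + the two return
counts). [cite: QuekEtAl2024, Methods §1.2 Definition 3] [cite: LevinPeres2017, §12.1] -/
theorem not_fam_isCliffordMixingLayer (h1 : Fintype.card ι = 1) (L : ℕ) :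
    ¬ IsCliffordMixingLayer (lwordU (famA (ι := ι)) (L + 1)) (lwalk famA (L + 1)) ∧
      ¬ IsCliffordMixingLayer (lwordU (famB (ι := ι)) (L + 1)) (lwalk famB (L + 1)) := by
  haveI : Nonempty ι := Fintype.card_pos_iff.mp (by omega)
  have hX : (fun _ : ι => Pauli.X) ≠ (idStr : ι → Pauli) := fun h => by
    have := congrFun h (Classical.arbitrary ι); exact Pauli.noConfusion this
  have hY : (fun _ : ι => Pauli.Y) ≠ (idStr : ι → Pauli) := fun h => by
    have := congrFun h (Classical.arbitrary ι); exact Pauli.noConfusion this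
  rw [isCliffordMixingLayer_iff_depth_one, isCliffordMixingLayer_one_iff, isCliffordMixingLayer_iff_depth_one,
    isCliffordMixingLayer_one_iff, Fintype.card_fin, Fintype.card_fin, h1]
  refine ⟨fun h => ?_, fun h => ?_⟩
  · have h2 := h _ _ hX hX
    rw [lstep_famA_X h1] at h2
    norm_num at h2
  · have h2 := h _ _ hY hY
    rw [lstep_famB_Y h1] at h2
    norm_num at h2

/-- **THE ONE-WIRE INHABITANT, kernel form**: two NONZERO symmetric defects with `D_A D_B = 0`, and the flat product
`K_A K_B = 2J` — an exactly mixing position-dependent letter law NONE of whose layers is exactly mixing, i.e. the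
configuration `LetterLaw.isCliffordMixingLayer_iff_depth_one` forbids for i.i.d. letters. [cite: LevinPeres2017,
§12.1] [cite: QuekEtAl2024, Methods §1.2 Definition 3] -/
theorem onewire_inhabitant (h1 : Fintype.card ι = 1) :
    IsCliffordMixingLayer (pwordU (famA (ι := ι)) famB) (pwalk famA famB) ∧
      kernel (famA (ι := ι)) * kernel famB = (2 : ℝ) • ones ∧
      defect (famA (ι := ι)) * defect famB = 0 ∧ defect (famA (ι := ι)) ≠ 0 ∧ defect (famB (ι := ι)) ≠ 0 := by
  haveI : Nonempty ι := Fintype.card_pos_iff.mp (by omega)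
  have hAB := famAB_isCliffordMixingLayer h1
  have hK := (isCliffordMixingLayer_pair_iff_kernel famA famB).mp hAB
  rw [Fintype.card_fin, Fintype.card_fin, h1] at hK
  refine ⟨hAB, ?_, (isCliffordMixingLayer_pair_iff_defect famA famB).mp hAB, fun h => ?_, fun h => ?_⟩
  · rw [hK]; norm_num
  · exact (not_fam_isCliffordMixingLayer h1 0).1 ((isCliffordMixingLayer_one_iff_defect famA).mpr h)
  · exact (not_fam_isCliffordMixingLayer h1 0).2 ((isCliffordMixingLayer_one_iff_defect famB).mpr h)

/-! ## 8. Numbers on two wires -/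

/-- **NUMBERS, two wires** (`N = 4² − 1 = 15`): the `16`-letter uniform family paired with itself fails
INTEGRALITY (`|κA||κB| = 256`, `15 ∤ 256`); the `15` non-identity letters paired with themselves PASS it
(`15 ∣ 225`) — and by § 5 NO pair whatsoever is exactly mixing: every pair fixes at least `4²/4 = 4` labels, i.e.
at least `3` non-identity ones, against the `1` on average that exactness demands. [cite: ZhuEtAl2016, §1]
[cite: QuekEtAl2024, Methods §1.2 Definition 3] -/
theorem numbers_two (h2 : Fintype.card ι = 2) :
    4 ^ Fintype.card ι - 1 = 15 ∧
      ¬ (4 ^ Fintype.card ι - 1 ∣ Fintype.card (ι → Pauli) * Fintype.card (ι → Pauli)) ∧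
      (4 ^ Fintype.card ι - 1 ∣
          Fintype.card {S : ι → Pauli // S ≠ idStr} * Fintype.card {S : ι → Pauli // S ≠ idStr}) ∧
      (∀ (A : κA → ι → Pauli) (B : κB → ι → Pauli) (p : κA × κB),
          (4 : ℝ) ≤ ∑ U : ι → Pauli, if pwalk A B p U = U then (1 : ℝ) else 0) ∧
      ∀ (A : κA → ι → Pauli) (B : κB → ι → Pauli) [Nonempty κA] [Nonempty κB],
        ¬ IsCliffordMixingLayer (pwordU A B) (pwalk A B) := by
  have hN : 4 ^ Fintype.card ι - 1 = 15 := by rw [h2]; norm_num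
  have hall : Fintype.card (ι → Pauli) = 16 := by rw [Fintype.card_fun, Pauli.card_univ, h2]; norm_num
  have hnon : Fintype.card {S : ι → Pauli // S ≠ idStr} = 15 := by rw [card_nonId_nat, h2]; norm_num
  refine ⟨hN, by rw [hN, hall]; norm_num, by rw [hN, hnon]; exact dvd_mul_right 15 15, fun A B p => ?_,
    fun A B _ _ => not_isCliffordMixingLayer_pair (by omega) A B⟩
  have h := fixed_ge A B p
  rw [h2, show (4 : ℝ) ^ 2 / 4 = 4 by norm_num] at h
  exact h

end PauliMixingPurity.RotationWords.LetterLaw.TwoLayer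

end Literature.Computability.QuantumComplexity
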